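import Mathlib
import HarnessLib
import Literature.NumberTheory.LFunctions.ZetaSubconvexity
import Literature.NumberTheory.LFunctions.ZetaABProcess
import Literature.NumberTheory.LFunctions.ZetaWeylBound

/-!
# Bourgain 2017, eq. (4.2): the exponent pair `(1/9, 13/18)` for `F = log` — discharge of
# `Literature.NumberTheory.LFunctions.Bourgain2017_eq42_log`

Topic `Literature/NumberTheory/LFunctions`. Bourgain, *J. Amer. Math. Soc.* **30** (2017), §5,
eq. (4.2): "the exponent pair estimate `|S| ≪ (T/M)^{1/9} M^{13/18} = M^{11/18} T^{1/9}`
(`0 ≤ α ≤ 1`), which corresponds to the exponent pair `(1/9, 13/18) = ABA²B(0,1)` mentioned in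
[T], §5.20", for `S = ∑_{M/2 ≤ m ≤ M} e(T log(m/M))`, i.e. `|S| = |∑_{M/2 ≤ m ≤ M} m^{it}|`,
`t = 2πT` (`Literature.NumberTheory.LFunctions.norm_bourgainSum_log`). The named fact
`Literature.NumberTheory.LFunctions.Bourgain2017_eq42_log` (`ZetaSubconvexity.lean`) records it
for `T` large and `1 ≤ M ≤ T`; here it is PROVED (`Bourgain2017_eq42_log_holds`).

The proof is van der Corput's, range by range in `α = log M/log T` (`K = T = t/2π`):
* `M ≤ K^{5/13}`: the fourth-derivative test, i.e. the pair `A²B(0,1) = (1/14, 11/14)`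
  (`Literature.NumberTheory.LFunctions.VdC.norm_sum_Icc_cpow_mul_I_le`, `VanDerCorputDerivTests.lean`);
* `K^{5/13} ≤ M ≤ K^{1/2}/2`: the genuinely new range, the pair `ABA²B(0,1)` itself — one Weyl
  differencing, the `B`-process (Titchmarsh Thm 4.9) and the fourth-derivative test for the dual
  sums (`Literature.NumberTheory.LFunctions.VdC.norm_sum_e_phaseD_le_AB`, `ZetaABProcess.lean`,
  resting on `StationaryPhase.lean`, `VanDerCorputPoisson.lean`, `VanDerCorputBProcess.lean`,
  `ZetaBProcessPhase.lean`);
* `K^{1/2}/2 ≤ M ≤ K^{5/7}`: the third-derivative test, `AB(0,1) = (1/6, 2/3)`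
  (`Literature.NumberTheory.LFunctions.VdC.norm_sum_Icc_cpow_mul_I_le_third`, `ZetaWeylBound.lean`);
* `K^{7/11} ≤ M ≤ K`: the second-derivative test, `B(0,1) = (1/2, 1/2)`
  (`Literature.NumberTheory.LFunctions.VdC.kbound_two`).
In each range the estimate is at most a constant times `M^{11/18} K^{1/9}`; the exponent
bookkeeping is done on integral powers of roots `r = M^{1/N}`, `s = K^{1/N}`.

## Main results

* `Literature.NumberTheory.LFunctions.VdC.norm_sum_cpow_le_of_small`,
  `…norm_sum_cpow_le_R1`, `…norm_sum_cpow_le_R2`, `…norm_sum_cpow_le_R3`, `…norm_sum_cpow_le_R4`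
  — the four ranges (and small `M`).
* `Literature.NumberTheory.LFunctions.VdC.norm_sum_Icc_cpow_mul_I_le_AB` — **for `T ≥ 1`,
  `1 ≤ M ≤ T`: `‖∑_{M/2 ≤ m ≤ M} m^{2πiT}‖ ≤ C T^{1/9} M^{11/18}`** with an absolute `C`.
* `Literature.NumberTheory.LFunctions.Bourgain2017_eq42_log_holds` — **discharge of the named
  fact `Literature.NumberTheory.LFunctions.Bourgain2017_eq42_log`**.

## References

* J. Bourgain, *Decoupling, exponential sums and the Riemann zeta function*, J. Amer. Math. Soc.
  30 (2017), 205–224, §5 eq. (4.2).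
* E. C. Titchmarsh, *The Theory of the Riemann Zeta-Function*, 2nd ed., Thms 4.9, 5.9, 5.11,
  5.13, §5.20.
-/

noncomputable section

open Real Complex Finset

namespace Literature.NumberTheory.LFunctions
namespace VdC

/-! ### Roots -/

/-- `(M^{1/N})^n = M^q` when `n/N = q`. [folklore] -/
theorem root_pow_eq {M : ℝ} (hM : 0 ≤ M) {N : ℕ} (hN : N ≠ 0) (n : ℕ) (q : ℝ)
    (hq : (n : ℝ) / N = q) : (M ^ (1 / (N : ℝ))) ^ n = M ^ q := by
  rw [← Real.rpow_natCast, ← Real.rpow_mul hM, ← hq]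
  congr 1
  have : (N : ℝ) ≠ 0 := Nat.cast_ne_zero.2 hN
  field_simp

/-! ### The sum `∑_{M/2 ≤ m ≤ M} m^{it}` and its ends -/

/-- Notation-free facts about `j = ⌈M/2⌉ - 1`, `f = ⌊M⌋` for `M ≥ 4`:
`⌈M/2⌉ = j + 1`, `M/2 - 1 ≤ j < M/2`, `M - 1 < f ≤ M`. [folklore] -/
theorem ends_bounds {M : ℝ} (hM : 4 ≤ M) :
    ∃ j : ℕ, ⌈M / 2⌉₊ = j + 1 ∧ M / 2 - 1 ≤ j ∧ (j : ℝ) < M / 2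
      ∧ M - 1 < (⌊M⌋₊ : ℝ) ∧ (⌊M⌋₊ : ℝ) ≤ M := by
  have hM0 : 0 < M := by linarith
  obtain ⟨j, hj⟩ : ∃ j : ℕ, ⌈M / 2⌉₊ = j + 1 :=
    ⟨⌈M / 2⌉₊ - 1, by have := Nat.ceil_pos.2 (show 0 < M / 2 by positivity); omega⟩
  have hcM : M / 2 ≤ ⌈M / 2⌉₊ := Nat.le_ceil _
  have hcM' : (⌈M / 2⌉₊ : ℝ) < M / 2 + 1 := Nat.ceil_lt_add_one (by positivity)
  have hcj : (⌈M / 2⌉₊ : ℝ) = j + 1 := by rw [hj]; push_cast; ring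
  refine ⟨j, hj, by linarith, by linarith, ?_, Nat.floor_le hM0.le⟩
  have := Nat.lt_floor_add_one M
  linarith

/-- Small `M`: `‖∑_{M/2 ≤ m ≤ M} m^{it}‖ ≤ M/2 + 2`. [folklore] -/
theorem norm_sum_cpow_le_length {M : ℝ} (hM : 0 < M) (t : ℝ) :
    ‖∑ m ∈ Finset.Icc ⌈M / 2⌉₊ ⌊M⌋₊, (m : ℂ) ^ ((t : ℂ) * Complex.I)‖ ≤ M / 2 + 2 := by
  refine (norm_sum_le _ _).trans ?_
  have h1 : ∀ m ∈ Finset.Icc ⌈M / 2⌉₊ ⌊M⌋₊, ‖(m : ℂ) ^ ((t : ℂ) * Complex.I)‖ ≤ 1 := by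
    intro m hm
    have hc1 : 1 ≤ ⌈M / 2⌉₊ := Nat.one_le_iff_ne_zero.2 (Nat.ceil_pos.2 (by positivity)).ne'
    have hm0 : 0 < m := lt_of_lt_of_le hc1 (Finset.mem_Icc.1 hm).1
    rw [Complex.norm_natCast_cpow_of_pos hm0]
    simp
  refine (Finset.sum_le_sum h1).trans ?_
  rw [Finset.sum_const, nsmul_eq_mul, mul_one, Nat.card_Icc]
  have hcM : M / 2 ≤ ⌈M / 2⌉₊ := Nat.le_ceil _
  have hfM : (⌊M⌋₊ : ℝ) ≤ M := Nat.floor_le hM.le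
  rcases le_or_gt ⌈M / 2⌉₊ (⌊M⌋₊ + 1) with h | h
  · rw [Nat.cast_sub h]
    push_cast
    linarith
  · rw [Nat.sub_eq_zero_of_le h.le]
    push_cast
    linarith

/-- **Small `M`**: for `1 ≤ M ≤ 1026` and `T ≥ 1`, `‖∑ m^{it}‖ ≤ 1026 T^{1/9} M^{11/18}`. [folklore] -/
theorem norm_sum_cpow_le_of_small {M T : ℝ} (hM : 1 ≤ M) (hM' : M ≤ 1026) (hT : 1 ≤ T) (t : ℝ) :
    ‖∑ m ∈ Finset.Icc ⌈M / 2⌉₊ ⌊M⌋₊, (m : ℂ) ^ ((t : ℂ) * Complex.I)‖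
      ≤ 1026 * (T ^ (1 / 9 : ℝ) * M ^ (11 / 18 : ℝ)) := by
  have h1 := norm_sum_cpow_le_length (M := M) (by linarith) t
  have h2 : (1 : ℝ) ≤ T ^ (1 / 9 : ℝ) * M ^ (11 / 18 : ℝ) :=
    one_le_mul_of_one_le_of_one_le (Real.one_le_rpow hT (by norm_num))
      (Real.one_le_rpow hM (by norm_num))
  nlinarith

/-! ### Range 1: `M ≤ K^{5/13}`, the fourth-derivative test -/

/-- **`M ≤ K^{5/13}`**: from `‖∑ m^{it}‖ ≤ C(M^{5/7}t^{1/14} + M^{29/28}t^{-1/14})` (`t = 2πK`),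
`‖∑ m^{2πiK}‖ ≤ 3C K^{1/9} M^{11/18}`. [cite: Titchmarsh1986, Thm 5.13] -/
theorem norm_sum_cpow_le_R1 {C : ℝ} (hC0 : 0 ≤ C)
    (hC : ∀ t : ℝ, 1 ≤ t → ∀ M : ℝ, 1 ≤ M →
      ‖∑ m ∈ Finset.Icc ⌈M / 2⌉₊ ⌊M⌋₊, (m : ℂ) ^ ((t : ℂ) * Complex.I)‖
        ≤ C * (M ^ (5 / 7 : ℝ) * t ^ (1 / 14 : ℝ) + M ^ (29 / 28 : ℝ) * t ^ (-(1 / 14 : ℝ))))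
    {K M : ℝ} (hK : 1 ≤ K) (hM : 1 ≤ M) (hMK : M ≤ K ^ (5 / 13 : ℝ)) :
    ‖∑ m ∈ Finset.Icc ⌈M / 2⌉₊ ⌊M⌋₊, (m : ℂ) ^ (((2 * π * K : ℝ) : ℂ) * Complex.I)‖
      ≤ 3 * C * (K ^ (1 / 9 : ℝ) * M ^ (11 / 18 : ℝ)) := by
  have hK0 : 0 < K := by linarith
  have hM0 : 0 < M := by linarith
  have hπ : 0 < π := Real.pi_pos
  have ht1 : 1 ≤ 2 * π * K := by nlinarith [Real.pi_gt_three]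
  have h := hC (2 * π * K) ht1 M hM
  refine h.trans ?_
  -- roots: `r = M^{1/3276}`, `s = K^{1/3276}`
  set r : ℝ := M ^ (1 / ((3276 : ℕ) : ℝ)) with hr
  set s : ℝ := K ^ (1 / ((3276 : ℕ) : ℝ)) with hs
  have hr0 : 0 < r := Real.rpow_pos_of_pos hM0 _
  have hs0 : 0 < s := Real.rpow_pos_of_pos hK0 _
  have hs1 : 1 ≤ s := Real.one_le_rpow hK (by positivity)
  have eM57 : M ^ (5 / 7 : ℝ) = r ^ 2340 := (root_pow_eq hM0.le (by norm_num) 2340 _ (by norm_num)).symm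
  have eM2928 : M ^ (29 / 28 : ℝ) = r ^ 3393 := (root_pow_eq hM0.le (by norm_num) 3393 _ (by norm_num)).symm
  have eM1118 : M ^ (11 / 18 : ℝ) = r ^ 2002 := (root_pow_eq hM0.le (by norm_num) 2002 _ (by norm_num)).symm
  have eM1 : M = r ^ 3276 := by
    have := root_pow_eq hM0.le (by norm_num : (3276 : ℕ) ≠ 0) 3276 1 (by norm_num)
    rw [Real.rpow_one] at this; exact this.symm
  have eK114 : K ^ (1 / 14 : ℝ) = s ^ 234 := (root_pow_eq hK0.le (by norm_num) 234 _ (by norm_num)).symm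
  have eK19 : K ^ (1 / 9 : ℝ) = s ^ 364 := (root_pow_eq hK0.le (by norm_num) 364 _ (by norm_num)).symm
  have eK513 : K ^ (5 / 13 : ℝ) = s ^ 1260 := (root_pow_eq hK0.le (by norm_num) 1260 _ (by norm_num)).symm
  -- hypothesis: `r¹³ ≤ s⁵`
  have hrs : r ^ 13 ≤ s ^ 5 := by
    have h1 : r ^ 3276 ≤ s ^ 1260 := by rw [← eM1, ← eK513]; exact hMK
    have h2 : (r ^ 13) ^ 252 ≤ (s ^ 5) ^ 252 := by rw [← pow_mul, ← pow_mul]; exact h1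
    exact le_of_pow_le_pow_left₀ (by norm_num) (by positivity) h2
  -- `t^{1/14} ≤ 2 K^{1/14}`, `t^{-1/14} ≤ K^{-1/14}`
  have ht14 : (2 * π * K) ^ (1 / 14 : ℝ) ≤ 2 * s ^ 234 := by
    rw [Real.mul_rpow (by positivity) hK0.le, eK114]
    have : (2 * π) ^ (1 / 14 : ℝ) ≤ 2 := by
      calc (2 * π) ^ (1 / 14 : ℝ) ≤ ((2 : ℝ) ^ 14) ^ (1 / 14 : ℝ) :=
            Real.rpow_le_rpow (by positivity) (by nlinarith [Real.pi_lt_four]) (by norm_num)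
        _ = 2 := by
            rw [show (1 / 14 : ℝ) = ((14 : ℕ) : ℝ)⁻¹ by norm_num]
            exact Real.pow_rpow_inv_natCast (by norm_num) (by norm_num)
    exact mul_le_mul_of_nonneg_right this (by positivity)
  have ht14' : (2 * π * K) ^ (-(1 / 14 : ℝ)) ≤ (s ^ 234)⁻¹ := by
    rw [← eK114, ← Real.rpow_neg hK0.le]
    exact Real.rpow_le_rpow_of_nonpos hK0 (by nlinarith [Real.pi_gt_three]) (by norm_num)
  rw [eM57, eM2928, eM1118, eK19]
  have hA : r ^ 2340 * (2 * π * K) ^ (1 / 14 : ℝ) ≤ 2 * (s ^ 364 * r ^ 2002) := by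
    calc r ^ 2340 * (2 * π * K) ^ (1 / 14 : ℝ) ≤ r ^ 2340 * (2 * s ^ 234) :=
          mul_le_mul_of_nonneg_left ht14 (by positivity)
      _ = 2 * (r ^ 2002 * s ^ 234) * (r ^ 13) ^ 26 := by ring
      _ ≤ 2 * (r ^ 2002 * s ^ 234) * (s ^ 5) ^ 26 := by
          gcongr
      _ = 2 * (s ^ 364 * r ^ 2002) := by ring
  have hB : r ^ 3393 * (2 * π * K) ^ (-(1 / 14 : ℝ)) ≤ s ^ 364 * r ^ 2002 := by
    calc r ^ 3393 * (2 * π * K) ^ (-(1 / 14 : ℝ)) ≤ r ^ 3393 * (s ^ 234)⁻¹ :=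
          mul_le_mul_of_nonneg_left ht14' (by positivity)
      _ ≤ s ^ 364 * r ^ 2002 := by
          rw [mul_inv_le_iff₀ (by positivity)]
          calc r ^ 3393 = r ^ 2002 * (r ^ 13) ^ 107 := by ring
            _ ≤ r ^ 2002 * (s ^ 5) ^ 107 := by gcongr
            _ = r ^ 2002 * s ^ 535 := by ring
            _ ≤ r ^ 2002 * s ^ 598 :=
                mul_le_mul_of_nonneg_left (pow_le_pow_right₀ hs1 (by norm_num)) (by positivity)
            _ = s ^ 364 * r ^ 2002 * s ^ 234 := by ring
  have h0 : 0 ≤ s ^ 364 * r ^ 2002 := by positivity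
  nlinarith

/-! ### Range 2: `K^{1/2}/2 ≤ M ≤ K^{5/7}`, the third-derivative test -/

/-- **`K^{1/2}/2 ≤ M ≤ K^{5/7}`**: from `‖∑ m^{it}‖ ≤ C(M^{1/2}t^{1/6} + M t^{-1/6})` (`t = 2πK`),
`‖∑ m^{2πiK}‖ ≤ 5C K^{1/9} M^{11/18}`. [cite: Titchmarsh1986, Thm 5.11] -/
theorem norm_sum_cpow_le_R2 {C : ℝ} (hC0 : 0 ≤ C)
    (hC : ∀ t : ℝ, 1 ≤ t → ∀ M : ℝ, 1 ≤ M →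
      ‖∑ m ∈ Finset.Icc ⌈M / 2⌉₊ ⌊M⌋₊, (m : ℂ) ^ ((t : ℂ) * Complex.I)‖
        ≤ C * (M ^ (1 / 2 : ℝ) * t ^ (1 / 6 : ℝ) + M * t ^ (-(1 / 6 : ℝ))))
    {K M : ℝ} (hK : 1 ≤ K) (hM : 1 ≤ M) (hKM : K ≤ 4 * M ^ 2) (hMK : M ≤ K ^ (5 / 7 : ℝ)) :
    ‖∑ m ∈ Finset.Icc ⌈M / 2⌉₊ ⌊M⌋₊, (m : ℂ) ^ (((2 * π * K : ℝ) : ℂ) * Complex.I)‖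
      ≤ 5 * C * (K ^ (1 / 9 : ℝ) * M ^ (11 / 18 : ℝ)) := by
  have hK0 : 0 < K := by linarith
  have hM0 : 0 < M := by linarith
  have hπ : 0 < π := Real.pi_pos
  have ht1 : 1 ≤ 2 * π * K := by nlinarith [Real.pi_gt_three]
  have h := hC (2 * π * K) ht1 M hM
  refine h.trans ?_
  -- roots: `r = M^{1/126}`, `s = K^{1/126}`
  set r : ℝ := M ^ (1 / ((126 : ℕ) : ℝ)) with hr
  set s : ℝ := K ^ (1 / ((126 : ℕ) : ℝ)) with hs
  have hr0 : 0 < r := Real.rpow_pos_of_pos hM0 _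
  have hs0 : 0 < s := Real.rpow_pos_of_pos hK0 _
  have eM12 : M ^ (1 / 2 : ℝ) = r ^ 63 := (root_pow_eq hM0.le (by norm_num) 63 _ (by norm_num)).symm
  have eM1118 : M ^ (11 / 18 : ℝ) = r ^ 77 := (root_pow_eq hM0.le (by norm_num) 77 _ (by norm_num)).symm
  have eM1 : M = r ^ 126 := by
    have := root_pow_eq hM0.le (by norm_num : (126 : ℕ) ≠ 0) 126 1 (by norm_num)
    rw [Real.rpow_one] at this; exact this.symm
  have eK16 : K ^ (1 / 6 : ℝ) = s ^ 21 := (root_pow_eq hK0.le (by norm_num) 21 _ (by norm_num)).symm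
  have eK19 : K ^ (1 / 9 : ℝ) = s ^ 14 := (root_pow_eq hK0.le (by norm_num) 14 _ (by norm_num)).symm
  have eK57 : K ^ (5 / 7 : ℝ) = s ^ 90 := (root_pow_eq hK0.le (by norm_num) 90 _ (by norm_num)).symm
  have eK1 : K = s ^ 126 := by
    have := root_pow_eq hK0.le (by norm_num : (126 : ℕ) ≠ 0) 126 1 (by norm_num)
    rw [Real.rpow_one] at this; exact this.symm
  -- hypotheses: `s⁷ ≤ 2 r¹⁴`, `r⁷ ≤ s⁵`
  have h1 : s ^ 7 ≤ 2 * r ^ 14 := by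
    have hh : s ^ 126 ≤ 4 * (r ^ 126) ^ 2 := by rw [← eK1, ← eM1]; exact hKM
    have h2 : (s ^ 7) ^ 18 ≤ (2 * r ^ 14) ^ 18 := by
      calc (s ^ 7) ^ 18 = s ^ 126 := by ring
        _ ≤ 4 * (r ^ 126) ^ 2 := hh
        _ ≤ 2 ^ 18 * (r ^ 126) ^ 2 := by nlinarith [pow_nonneg hr0.le 126]
        _ = (2 * r ^ 14) ^ 18 := by ring
    exact le_of_pow_le_pow_left₀ (by norm_num) (by positivity) h2
  have h2 : r ^ 7 ≤ s ^ 5 := by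
    have hh : r ^ 126 ≤ s ^ 90 := by rw [← eM1, ← eK57]; exact hMK
    have h2 : (r ^ 7) ^ 18 ≤ (s ^ 5) ^ 18 := by rw [← pow_mul, ← pow_mul]; exact hh
    exact le_of_pow_le_pow_left₀ (by norm_num) (by positivity) h2
  -- `t^{1/6} ≤ 2 K^{1/6}`, `t^{-1/6} ≤ K^{-1/6}`
  have ht16 : (2 * π * K) ^ (1 / 6 : ℝ) ≤ 2 * s ^ 21 := by
    rw [Real.mul_rpow (by positivity) hK0.le, eK16]
    have : (2 * π) ^ (1 / 6 : ℝ) ≤ 2 := by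
      calc (2 * π) ^ (1 / 6 : ℝ) ≤ ((2 : ℝ) ^ 6) ^ (1 / 6 : ℝ) :=
            Real.rpow_le_rpow (by positivity) (by nlinarith [Real.pi_lt_four]) (by norm_num)
        _ = 2 := by
            rw [show (1 / 6 : ℝ) = ((6 : ℕ) : ℝ)⁻¹ by norm_num]
            exact Real.pow_rpow_inv_natCast (by norm_num) (by norm_num)
    exact mul_le_mul_of_nonneg_right this (by positivity)
  have ht16' : (2 * π * K) ^ (-(1 / 6 : ℝ)) ≤ (s ^ 21)⁻¹ := by
    rw [← eK16, ← Real.rpow_neg hK0.le]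
    exact Real.rpow_le_rpow_of_nonpos hK0 (by nlinarith [Real.pi_gt_three]) (by norm_num)
  rw [eM12, eM1118, eK19, eM1]
  have hA : r ^ 63 * (2 * π * K) ^ (1 / 6 : ℝ) ≤ 4 * (s ^ 14 * r ^ 77) := by
    calc r ^ 63 * (2 * π * K) ^ (1 / 6 : ℝ) ≤ r ^ 63 * (2 * s ^ 21) :=
          mul_le_mul_of_nonneg_left ht16 (by positivity)
      _ = 2 * (r ^ 63 * s ^ 14) * s ^ 7 := by ring
      _ ≤ 2 * (r ^ 63 * s ^ 14) * (2 * r ^ 14) := by gcongr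
      _ = 4 * (s ^ 14 * r ^ 77) := by ring
  have hB : r ^ 126 * (2 * π * K) ^ (-(1 / 6 : ℝ)) ≤ s ^ 14 * r ^ 77 := by
    calc r ^ 126 * (2 * π * K) ^ (-(1 / 6 : ℝ)) ≤ r ^ 126 * (s ^ 21)⁻¹ :=
          mul_le_mul_of_nonneg_left ht16' (by positivity)
      _ ≤ s ^ 14 * r ^ 77 := by
          rw [mul_inv_le_iff₀ (by positivity)]
          calc r ^ 126 = r ^ 77 * (r ^ 7) ^ 7 := by ring
            _ ≤ r ^ 77 * (s ^ 5) ^ 7 := by gcongr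
            _ = s ^ 14 * r ^ 77 * s ^ 21 := by ring
  have h0 : 0 ≤ s ^ 14 * r ^ 77 := by positivity
  nlinarith

/-! ### Range 3: `K^{7/11} ≤ M ≤ K`, the second-derivative test -/

/-- **`K^{7/11} ≤ M ≤ K`** (`M ≥ 4`): by the second-derivative test
(`f(y) = (t/2π) log y`, `-f'' = K/y² ∈ [K/M², 16K/M²]` on `[M/4, M]`),
`‖∑ m^{2πiK}‖ ≤ 384 K^{1/2} ≤ 384 K^{1/9} M^{11/18}`. [cite: Titchmarsh1986, Thm 5.9] -/
theorem norm_sum_cpow_le_R3 {K M : ℝ} (hK : 1 ≤ K) (hM : 4 ≤ M) (hMK : M ≤ K)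
    (hKM : K ^ (7 / 11 : ℝ) ≤ M) :
    ‖∑ m ∈ Finset.Icc ⌈M / 2⌉₊ ⌊M⌋₊, (m : ℂ) ^ (((2 * π * K : ℝ) : ℂ) * Complex.I)‖
      ≤ 384 * (K ^ (1 / 9 : ℝ) * M ^ (11 / 18 : ℝ)) := by
  have hK0 : 0 < K := by linarith
  have hM0 : 0 < M := by linarith
  have hπ : 0 < π := Real.pi_pos
  obtain ⟨j, hj, hjlo, hjhi, hflo, hfhi⟩ := ends_bounds hM
  set t : ℝ := 2 * π * K with ht
  have hKt : t / (2 * π) = K := by rw [ht]; field_simp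
  rw [hj, sum_Icc_cpow_mul_I_eq_sum_e_phaseD t j ⌊M⌋₊]
  -- the second-derivative test
  have hj0 : (0 : ℝ) < j := by linarith
  have hjf : (j : ℤ) < (⌊M⌋₊ : ℕ) := by
    have : (j : ℝ) < ⌊M⌋₊ := by linarith
    exact_mod_cast this
  set lam : ℝ := K / M ^ 2 with hlam
  have hlam0 : 0 < lam := by positivity
  have hfam : DerivFamily (phaseD (-t)) ((j : ℤ) : ℝ) (((⌊M⌋₊ : ℕ) : ℤ) : ℝ) 2 :=
    phaseD_derivFamily (-t) (by push_cast; exact hj0) 2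
  have hbound : ∀ y ∈ Set.Icc ((j : ℤ) : ℝ) (((⌊M⌋₊ : ℕ) : ℤ) : ℝ),
      lam ≤ (-1) * phaseD (-t) 2 y ∧ (-1) * phaseD (-t) 2 y ≤ 16 * lam := by
    intro y hy
    push_cast at hy
    have hy0 : 0 < y := by linarith [hy.1]
    have hyM : y ≤ M := by linarith [hy.2]
    have hyM' : M / 4 ≤ y := by linarith [hy.1]
    rw [phaseD_negt_two, hKt]
    rw [show (-1) * (-K * (y ^ 2)⁻¹) = K / y ^ 2 by ring]
    constructor
    · exact div_le_div_of_nonneg_left hK0.le (by positivity) (pow_le_pow_left₀ hy0.le hyM 2)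
    · rw [hlam, show 16 * (K / M ^ 2) = K / (M / 4) ^ 2 by field_simp; ring]
      exact div_le_div_of_nonneg_left hK0.le (by positivity) (pow_le_pow_left₀ (by positivity) hyM' 2)
  have hKb := (kbound_two (h := 16) (by norm_num)).signed (Or.inr rfl) hlam0 hjf hfam hbound
  refine hKb.trans ?_
  -- bookkeeping: `(b - a) λ^{1/2} ≤ √K`, `λ^{-1/2} = M/√K ≤ √K`, `√K ≤ K^{1/9}M^{11/18}`
  set L : ℝ := (((⌊M⌋₊ : ℕ) : ℤ) : ℝ) - ((j : ℤ) : ℝ) with hL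
  have hL0 : 0 < L := by rw [hL]; push_cast; linarith
  have hLM : L ≤ M := by rw [hL]; push_cast; linarith
  have hsK : 0 < Real.sqrt K := Real.sqrt_pos.2 hK0
  have e1 : lam ^ (1 / 2 : ℝ) = Real.sqrt K / M := by
    rw [← Real.sqrt_eq_rpow, hlam, Real.sqrt_div' _ (by positivity), Real.sqrt_sq hM0.le]
  have e2 : lam ^ (-((1 : ℝ) / 2)) = M / Real.sqrt K := by
    rw [Real.rpow_neg hlam0.le, e1, inv_div]
  have e3 : L ^ (1 - (1 : ℝ)) = 1 := by norm_num
  rw [e1, e2, e3, one_mul]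
  have hT1 : L * (Real.sqrt K / M) ≤ Real.sqrt K := by
    rw [mul_div_assoc', div_le_iff₀ hM0]
    nlinarith [mul_le_mul_of_nonneg_left hLM hsK.le]
  have hT2 : M / Real.sqrt K ≤ Real.sqrt K := by
    rw [div_le_iff₀ hsK, Real.mul_self_sqrt hK0.le]; exact hMK
  -- roots `r = M^{1/198}`, `s = K^{1/198}`
  set r : ℝ := M ^ (1 / ((198 : ℕ) : ℝ)) with hr
  set s : ℝ := K ^ (1 / ((198 : ℕ) : ℝ)) with hs
  have hr0 : 0 < r := Real.rpow_pos_of_pos hM0 _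
  have hs0 : 0 < s := Real.rpow_pos_of_pos hK0 _
  have eM1118 : M ^ (11 / 18 : ℝ) = r ^ 121 := (root_pow_eq hM0.le (by norm_num) 121 _ (by norm_num)).symm
  have eM1 : M = r ^ 198 := by
    have := root_pow_eq hM0.le (by norm_num : (198 : ℕ) ≠ 0) 198 1 (by norm_num)
    rw [Real.rpow_one] at this; exact this.symm
  have eK19 : K ^ (1 / 9 : ℝ) = s ^ 22 := (root_pow_eq hK0.le (by norm_num) 22 _ (by norm_num)).symm
  have eK12 : Real.sqrt K = s ^ 99 := by
    rw [Real.sqrt_eq_rpow]; exact (root_pow_eq hK0.le (by norm_num) 99 _ (by norm_num)).symm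
  have eK711 : K ^ (7 / 11 : ℝ) = s ^ 126 := (root_pow_eq hK0.le (by norm_num) 126 _ (by norm_num)).symm
  have hsr : s ^ 7 ≤ r ^ 11 := by
    have hh : s ^ 126 ≤ r ^ 198 := by rw [← eK711, ← eM1]; exact hKM
    have h2 : (s ^ 7) ^ 18 ≤ (r ^ 11) ^ 18 := by rw [← pow_mul, ← pow_mul]; exact hh
    exact le_of_pow_le_pow_left₀ (by norm_num) (by positivity) h2
  have hT3 : Real.sqrt K ≤ K ^ (1 / 9 : ℝ) * M ^ (11 / 18 : ℝ) := by
    rw [eK12, eK19, eM1118]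
    calc s ^ 99 = s ^ 22 * (s ^ 7) ^ 11 := by ring
      _ ≤ s ^ 22 * (r ^ 11) ^ 11 := by gcongr
      _ = s ^ 22 * r ^ 121 := by ring
  nlinarith [hT1, hT2, hT3, hL0]

/-! ### Range 4: `K^{5/13} ≤ M ≤ K^{1/2}/2`, the `AB` step -/

/-- **`K^{5/13} ≤ M ≤ K^{1/2}/2`** (`M ≥ 512`, `K ≥ 1`): `‖∑ m^{2πiK}‖ ≤ 2⁴⁵ K^{1/9} M^{11/18}`
(`Literature.NumberTheory.LFunctions.VdC.norm_sum_e_phaseD_le_AB`).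
[cite: BourgainJAMS2017, §5 eq. (4.2)] -/
theorem norm_sum_cpow_le_R4 {K M : ℝ} (hK : 1 ≤ K) (hM : 512 ≤ M) (hKM : K ^ (5 / 13 : ℝ) ≤ M)
    (hMK : M ^ 2 ≤ K / 4) :
    ‖∑ m ∈ Finset.Icc ⌈M / 2⌉₊ ⌊M⌋₊, (m : ℂ) ^ (((2 * π * K : ℝ) : ℂ) * Complex.I)‖
      ≤ 2 ^ 45 * (K ^ (1 / 9 : ℝ) * M ^ (11 / 18 : ℝ)) := by
  have hK0 : 0 < K := by linarith
  have hπ : 0 < π := Real.pi_pos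
  obtain ⟨j, hj, hjlo, hjhi, hflo, hfhi⟩ := ends_bounds (by linarith : (4 : ℝ) ≤ M)
  set t : ℝ := 2 * π * K with ht
  have hKt : t / (2 * π) = K := by rw [ht]; field_simp
  rw [hj, sum_Icc_cpow_mul_I_eq_sum_e_phaseD t j ⌊M⌋₊]
  have hkey := norm_sum_e_phaseD_le_AB (t := t) (M := M) (j := j) (f := ⌊M⌋₊)
    (by rw [ht]; positivity)
    (by rw [hKt]; exact hK) hM (by rw [hKt]; exact hKM) (by rw [hKt]; exact hMK)
    (by linarith) (by linarith) hfhi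
  rw [hKt] at hkey
  linarith

/-! ### All ranges -/

/-- **`‖∑_{M/2 ≤ m ≤ M} m^{2πiK}‖ ≤ C K^{1/9} M^{11/18}` for `K ≥ 1`, `1 ≤ M ≤ K`** (the exponent pair
`(1/9, 13/18) = ABA²B(0,1)` for `f(y) = K log y`), with an absolute constant `C`.
[cite: BourgainJAMS2017, §5 eq. (4.2)] [cite: Titchmarsh1986, §5.20] -/
theorem norm_sum_Icc_cpow_mul_I_le_AB :
    ∃ C : ℝ, 0 ≤ C ∧ ∀ K : ℝ, 1 ≤ K → ∀ M : ℝ, 1 ≤ M → M ≤ K →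
      ‖∑ m ∈ Finset.Icc ⌈M / 2⌉₊ ⌊M⌋₊, (m : ℂ) ^ (((2 * π * K : ℝ) : ℂ) * Complex.I)‖
        ≤ C * (K ^ (1 / 9 : ℝ) * M ^ (11 / 18 : ℝ)) := by
  obtain ⟨C₁, hC₁0, hC₁⟩ := norm_sum_Icc_cpow_mul_I_le
  obtain ⟨C₂, hC₂0, hC₂⟩ := norm_sum_Icc_cpow_mul_I_le_third
  refine ⟨1026 + 3 * C₁ + 5 * C₂ + 384 + 2 ^ 45, by positivity, ?_⟩
  intro K hK M hM hMK
  have hK0 : 0 < K := by linarith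
  have hM0 : 0 < M := by linarith
  have hX : 0 ≤ K ^ (1 / 9 : ℝ) * M ^ (11 / 18 : ℝ) := by positivity
  have hbig : ∀ c : ℝ, 0 ≤ c → c ≤ 1026 + 3 * C₁ + 5 * C₂ + 384 + 2 ^ 45 →
      ∀ S : ℝ, S ≤ c * (K ^ (1 / 9 : ℝ) * M ^ (11 / 18 : ℝ)) →
        S ≤ (1026 + 3 * C₁ + 5 * C₂ + 384 + 2 ^ 45) * (K ^ (1 / 9 : ℝ) * M ^ (11 / 18 : ℝ)) :=
    fun c _ hc S hS => hS.trans (mul_le_mul_of_nonneg_right hc hX)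
  by_cases hsmall : M ≤ 1026
  · exact hbig 1026 (by norm_num) (by nlinarith [hC₁0, hC₂0]) _
      (norm_sum_cpow_le_of_small hM hsmall hK (2 * π * K))
  rw [not_le] at hsmall
  by_cases h1 : M ≤ K ^ (5 / 13 : ℝ)
  · exact hbig (3 * C₁) (by positivity) (by nlinarith [hC₂0]) _ (norm_sum_cpow_le_R1 hC₁0 hC₁ hK hM h1)
  rw [not_le] at h1
  by_cases h2 : M ^ 2 ≤ K / 4
  · exact hbig (2 ^ 45) (by norm_num) (by nlinarith [hC₁0, hC₂0]) _
      (norm_sum_cpow_le_R4 hK (by linarith) h1.le h2)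
  rw [not_le] at h2
  by_cases h3 : M ≤ K ^ (5 / 7 : ℝ)
  · exact hbig (5 * C₂) (by positivity) (by nlinarith [hC₁0]) _
      (norm_sum_cpow_le_R2 hC₂0 hC₂ hK hM (by linarith) h3)
  rw [not_le] at h3
  have h4 : K ^ (7 / 11 : ℝ) ≤ M := by
    refine le_trans ?_ h3.le
    exact Real.rpow_le_rpow_of_exponent_le hK (by norm_num)
  exact hbig 384 (by norm_num) (by nlinarith [hC₁0, hC₂0]) _
    (norm_sum_cpow_le_R3 hK (by linarith) hMK h4)

end VdC

/-! ### Discharge of `Bourgain2017_eq42_log` -/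

/-- **Bourgain 2017, eq. (4.2) for `F = log`, proved**: the exponent-pair estimate
`|S| ≪ (T/M)^{1/9} M^{13/18}` for `S = ∑_{M/2 ≤ m ≤ M} e(T log(m/M))`, `T ≥ 1`, `1 ≤ M ≤ T`
(the pair `(1/9, 13/18) = ABA²B(0,1)`, Titchmarsh §5.20), i.e. the named fact
`Literature.NumberTheory.LFunctions.Bourgain2017_eq42_log`.
[cite: BourgainJAMS2017, §5 eq. (4.2)] [cite: Titchmarsh1986, §5.20] -/
theorem Bourgain2017_eq42_log_holds : Bourgain2017_eq42_log := by
  obtain ⟨C, hC0, hC⟩ := VdC.norm_sum_Icc_cpow_mul_I_le_AB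
  refine ⟨C, 1, ?_⟩
  intro T hT M hM hMT
  have hM0 : 0 < M := by linarith
  have hT0 : 0 < T := by linarith
  rw [norm_bourgainSum_log hM0 T]
  have h := hC T hT M hM hMT
  refine h.trans (le_of_eq ?_)
  rw [Real.div_rpow hT0.le hM0.le, mul_assoc]
  congr 1
  rw [div_mul_eq_mul_div, eq_div_iff (by positivity), mul_assoc, ← Real.rpow_add hM0]
  norm_num

end Literature.NumberTheory.LFunctions

end
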